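import Mathlib.Topology.Compactification.OnePoint.Basic
import Mathlib.Analysis.Normed.Field.Lemmas
import Mathlib.Topology.Bornology.BoundedOperation
import Mathlib.Topology.MetricSpace.Bounded
import Mathlib.Topology.Homeomorph.Lemmas
import HarnessLib

/-!
# The Möbius inversion `z ↦ a + (z - a)⁻¹` of the projective line `ℙ¹(𝕜) = OnePoint 𝕜`:
# a self-homeomorphism swapping `a` and `∞`; `Homeo(ℙ¹)` moves every point to `∞`

Topic `Literature/Topology/PlaneTopology` — elementary topology of the Riemann sphere
`ℙ¹(ℂ) = OnePoint ℂ` (and of `OnePoint 𝕜` for any proper normed field `𝕜`), written for the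
id-rigidity instances `Cov(ℙ¹ ∖ S)` of the abc-iut cell's campaign-L R1 (to remove the
normalisation `∞ ∈ S`).  Mathlib has the `GL₂(𝕜)`-ACTION on `OnePoint 𝕜`
(`OnePoint.instGLAction`) but not its continuity; we topologise the one Möbius map we need:

* `OnePoint.inversion a` — `∞ ↦ a`, `a ↦ ∞`, `z ↦ a + (z - a)⁻¹`; `inversion_inversion`
  (an involution); **`continuous_inversion`**; **`OnePoint.inversionHomeomorph a : OnePoint 𝕜 ≃ₜ
  OnePoint 𝕜`**;
* **`OnePoint.exists_homeomorph_apply_eq_infty`** — every point of `ℙ¹(𝕜)` is moved to `∞` by a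
  self-homeomorphism.

Everything is proved; definitions `OnePoint.inversion`, `OnePoint.inversionHomeomorph`.

## References

* L. V. Ahlfors, *Complex Analysis*, 3rd ed., §1.2.4 / §3.3 (the extended plane and linear
  fractional transformations as homeomorphisms of the Riemann sphere). [folklore]
* A. Hatcher, *Algebraic Topology*, CUP 2002, §1.3. [HatcherAT2002]
-/

noncomputable section

open Filter Set Topology Bornology OnePoint

namespace OnePoint

variable {𝕜 : Type*} [NormedField 𝕜]

open scoped Classical in
/-- **The Möbius inversion centred at `a`**: `∞ ↦ a`, `a ↦ ∞`, `z ↦ a + (z - a)⁻¹` (`z ≠ a`).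
[cite: HatcherAT2002, §1.3 p.67] -/
def inversion (a : 𝕜) (x : OnePoint 𝕜) : OnePoint 𝕜 :=
  x.elim (a : OnePoint 𝕜) fun z ↦ if z = a then ∞ else ((a + (z - a)⁻¹ : 𝕜) : OnePoint 𝕜)

/-- `inversion a ∞ = a`. [cite: HatcherAT2002, §1.3 p.67] -/
@[simp] theorem inversion_infty (a : 𝕜) : inversion a ∞ = (a : OnePoint 𝕜) := rfl

/-- `inversion a a = ∞`. [cite: HatcherAT2002, §1.3 p.67] -/
@[simp] theorem inversion_coe_self (a : 𝕜) : inversion a (a : OnePoint 𝕜) = ∞ := by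
  simp [inversion]

/-- `inversion a z = a + (z - a)⁻¹` for `z ≠ a`. [cite: HatcherAT2002, §1.3 p.67] -/
theorem inversion_coe_of_ne (a : 𝕜) {z : 𝕜} (h : z ≠ a) :
    inversion a (z : OnePoint 𝕜) = ((a + (z - a)⁻¹ : 𝕜) : OnePoint 𝕜) := by
  simp [inversion, h]

/-- **The Möbius inversion is an involution.** [cite: HatcherAT2002, §1.3 p.67] -/
theorem inversion_inversion (a : 𝕜) (x : OnePoint 𝕜) : inversion a (inversion a x) = x := by
  induction x using OnePoint.rec with
  | infty => simp
  | coe z =>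
    by_cases h : z = a
    · subst h
      simp
    · have hza : z - a ≠ 0 := sub_ne_zero.2 h
      have hne : a + (z - a)⁻¹ ≠ a := by
        intro h'
        exact inv_ne_zero hza (by simpa using h')
      rw [inversion_coe_of_ne a h, inversion_coe_of_ne a hne]
      congr 1
      rw [add_sub_cancel_left, inv_inv, add_sub_cancel]

/-- The Möbius inversion is involutive. [cite: HatcherAT2002, §1.3 p.67] -/
theorem involutive_inversion (a : 𝕜) : Function.Involutive (inversion a) :=
  inversion_inversion a

/-- Away from `a`, the inversion agrees with the continuous map `z ↦ a + (z - a)⁻¹` eventually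
along the cobounded filter. [cite: HatcherAT2002, §1.3 p.67] -/
theorem inversion_coe_eventuallyEq_cobounded (a : 𝕜) :
    (fun z : 𝕜 ↦ inversion a (z : OnePoint 𝕜)) =ᶠ[cobounded 𝕜]
      fun z ↦ ((a + (z - a)⁻¹ : 𝕜) : OnePoint 𝕜) := by
  have h : ({a}ᶜ : Set 𝕜) ∈ cobounded 𝕜 := (Bornology.isBounded_singleton (x := a))
  filter_upwards [h] with z hz
  exact inversion_coe_of_ne a hz

/-- `inversion a z → a` as `z → ∞`. [cite: HatcherAT2002, §1.3 p.67] -/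
theorem tendsto_inversion_coe_cobounded (a : 𝕜) :
    Tendsto (fun z : 𝕜 ↦ inversion a (z : OnePoint 𝕜)) (cobounded 𝕜) (𝓝 (a : OnePoint 𝕜)) := by
  refine Tendsto.congr' (inversion_coe_eventuallyEq_cobounded a).symm ?_
  have h1 : Tendsto (fun z : 𝕜 ↦ (z - a)⁻¹) (cobounded 𝕜) (𝓝 0) :=
    tendsto_inv₀_cobounded.comp (tendsto_sub_const_cobounded a)
  have h2 : Tendsto (fun z : 𝕜 ↦ a + (z - a)⁻¹) (cobounded 𝕜) (𝓝 a) := by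
    simpa using h1.const_add a
  exact (continuous_coe.tendsto a).comp h2

variable [ProperSpace 𝕜]

/-- `inversion a z → ∞` as `z → a`, `z ≠ a` (`𝕜` proper, so that bounded-complement sets are
co-compact). [cite: HatcherAT2002, §1.3 p.67] -/
theorem tendsto_inversion_coe_nhdsNE (a : 𝕜) :
    Tendsto (fun z : 𝕜 ↦ inversion a (z : OnePoint 𝕜)) (𝓝[≠] a) (𝓝 ∞) := by
  have heq : (fun z : 𝕜 ↦ inversion a (z : OnePoint 𝕜)) =ᶠ[𝓝[≠] a]
      fun z ↦ ((a + (z - a)⁻¹ : 𝕜) : OnePoint 𝕜) := by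
    filter_upwards [self_mem_nhdsWithin] with z hz
    exact inversion_coe_of_ne a hz
  refine Tendsto.congr' heq.symm ?_
  have h0 : Tendsto (fun z : 𝕜 ↦ z - a) (𝓝[≠] a) (𝓝[≠] 0) := by
    refine tendsto_nhdsWithin_iff.2 ⟨?_, ?_⟩
    · have : Tendsto (fun z : 𝕜 ↦ z - a) (𝓝 a) (𝓝 (a - a)) :=
        (continuous_id.sub continuous_const).tendsto a
      rw [sub_self] at this
      exact tendsto_nhdsWithin_of_tendsto_nhds this
    · filter_upwards [self_mem_nhdsWithin] with z hz
      exact sub_ne_zero.2 hz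
  have h1 : Tendsto (fun z : 𝕜 ↦ a + (z - a)⁻¹) (𝓝[≠] a) (cobounded 𝕜) :=
    (tendsto_const_add_cobounded a).comp (tendsto_inv₀_nhdsNE_zero.comp h0)
  have h2 : Tendsto ((↑) : 𝕜 → OnePoint 𝕜) (cobounded 𝕜) (𝓝 ∞) := by
    rw [Metric.cobounded_eq_cocompact, ← coclosedCompact_eq_cocompact]
    exact tendsto_coe_infty
  exact h2.comp h1

/-- **The Möbius inversion is continuous on `ℙ¹(𝕜)`.** [cite: HatcherAT2002, §1.3 p.67] -/
theorem continuous_inversion (a : 𝕜) : Continuous (inversion a) := by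
  rw [OnePoint.continuous_iff]
  refine ⟨?_, ?_⟩
  · rw [coclosedCompact_eq_cocompact, ← Metric.cobounded_eq_cocompact, inversion_infty]
    exact tendsto_inversion_coe_cobounded a
  · rw [continuous_iff_continuousAt]
    intro z
    by_cases h : z = a
    · subst h
      change Tendsto _ (𝓝 z) (𝓝 (inversion z (z : OnePoint 𝕜)))
      rw [inversion_coe_self, ← nhdsNE_sup_pure z]
      refine (tendsto_inversion_coe_nhdsNE z).sup ?_
      rw [← inversion_coe_self z]
      exact tendsto_pure_nhds _ z
    · have heq : (fun w : 𝕜 ↦ inversion a (w : OnePoint 𝕜)) =ᶠ[𝓝 z]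
          fun w ↦ ((a + (w - a)⁻¹ : 𝕜) : OnePoint 𝕜) := by
        filter_upwards [isOpen_ne.mem_nhds h] with w hw
        exact inversion_coe_of_ne a hw
      refine ContinuousAt.congr ?_ heq.symm
      exact (continuous_coe.continuousAt).comp
        (continuousAt_const.add ((continuousAt_id.sub continuousAt_const).inv₀ (sub_ne_zero.2 h)))

/-- **The Möbius inversion as a self-homeomorphism of `ℙ¹(𝕜)`** (an involution).
[cite: HatcherAT2002, §1.3 p.67] -/
def inversionHomeomorph (a : 𝕜) : OnePoint 𝕜 ≃ₜ OnePoint 𝕜 where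
  toEquiv := (involutive_inversion a).toPerm _
  continuous_toFun := continuous_inversion a
  continuous_invFun := continuous_inversion a

/-- The homeomorphism is the inversion. [cite: HatcherAT2002, §1.3 p.67] -/
@[simp] theorem inversionHomeomorph_apply (a : 𝕜) (x : OnePoint 𝕜) :
    inversionHomeomorph a x = inversion a x := rfl

/-- The inversion homeomorphism sends `a` to `∞`. [cite: HatcherAT2002, §1.3 p.67] -/
theorem inversionHomeomorph_coe_self (a : 𝕜) : inversionHomeomorph a (a : OnePoint 𝕜) = ∞ :=
  inversion_coe_self a

/-- **Every point of `ℙ¹(𝕜)` is moved to `∞` by a self-homeomorphism** (the identity for `∞`, the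
Möbius inversion centred at `a` for a finite point `a`). [cite: HatcherAT2002, §1.3 p.67] -/
theorem exists_homeomorph_apply_eq_infty (x : OnePoint 𝕜) :
    ∃ φ : OnePoint 𝕜 ≃ₜ OnePoint 𝕜, φ x = ∞ := by
  induction x using OnePoint.rec with
  | infty => exact ⟨Homeomorph.refl _, rfl⟩
  | coe a => exact ⟨inversionHomeomorph a, inversionHomeomorph_coe_self a⟩

end OnePoint

end
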